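import Summits.Ventures.CertifiedManyBodySolver.Observables.SourcedGibbsTrialCapKSpace
import HarnessLib

/-!
# The HF–BCS sourced cap in momentum space (VIII): the Gibbs EXPECTATIONS themselves (energy and number per site)
# as the certified k-sums — the rows a density-matrix trial family carries into the thermodynamic limit

HONEST FRAMING: zero compute; identities only. Files I–III (`SourcedGibbsTrialCap*`) prove the CAP
`E₀(A_L(U,μ,h)) ≤ Re⟨A_L(U,μ,h)⟩_{β, A_L(0,μ',h)} = [k-space formula]` by chaining the variational principle with the
evaluation of the free pinned Gibbs state; only the inequality was exported. The canonical-class (fixed-density)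
packaging of the cap in the thermodynamic limit (`Literature/…/PairSourcedTorusGibbsTrialStateMixing.lean`: two Gibbs
trial families bracketing the density, mixed in infinite volume) consumes the EXPECTATION ROWS of the trial state —
its number per site and its sourced energy per site — so this file exports the equalities:

* §1 `re_gibbsState_eq_HFBCS_of_conj` — generic lattice: `Re⟨A'⟩_{β,A} = Re(Σ𝓗F − c) + a·ReΣ(F↑↑ + 1 − F↓↓) + U·ReΣ(Gaudin)`
  for `A' = A + aN + UΣn↑n↓`, `WAWᴴ = dΓ(𝓗) − c` (the equality inside `groundEnergy_le_HFBCS_of_conj`).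
* §2 the free `d`-wave pinned torus `A_L(0,μ',h)` (library instances): `re_gibbsState_dWaveSourceTorus_eq_HFBCS` (Nambu
  form), `re_gibbsState_dWaveSourceTorus_eq_kSpace` / `…_kSpace'` (momentum form, anomalous square kept / removed):
  `Re⟨A_L(U,μ,h)⟩ = (−Σ_k E_k t_k − μ'L²) + (μ'−μ)·Σ_k(1 − ξ_k t_k/E_k) + U·L²·(Σ_k(1 − ξ_k t_k/E_k)/(2L²))²`, and
  `re_gibbsState_dWaveSourceTorus_totalNumber_eq_kSpace`: `Re⟨N⟩ = Σ_k (1 − ξ_k t_k/E_k)` — the trial DENSITY per site is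
  `n_L = L⁻²Σ_k(1 − ξ_k t_k/E_k)`, exactly the `n` column the cell's two-engine interval tables certify.

References: Bach–Lieb–Solovej, J. Stat. Phys. 76 (1994) 3, §2 [BachLiebSolovej1994]; Gaudin, Nucl. Phys. 15 (1960) 89
[Gaudin1960]; Lieb, PRL 62 (1989) 1201, proof of Thm 2 [Lieb1989]; von Delft–Ralph, Phys. Rep. 345 (2001) 61, §4.2
[VondelftRalph2001]; Bratteli–Robinson II §5.2.4 [BratteliRobinsonII1997].
-/

noncomputable section

open Matrix Finset Literature.MathematicalPhysics.QuantumLattice Literature.Probability.LatticeModels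
open Literature.MathematicalPhysics.QuantumLattice.HubbardWave0
open scoped ComplexConjugate

namespace Summit.Ventures.CertifiedManyBodySolver.Observables

/-! ### §1 Generic lattice: the generalized-Hartree–Fock expectation identity -/

section HFBCS

variable {Λ : Type*} [LinearOrder Λ] [Fintype Λ]

/-- **Generalized-Hartree–Fock EXPECTATION identity, generic form.** Let `A' = A + a·N + U·Σ_x n_{x↑}n_{x↓}` and
`W A Wᴴ = dΓ(𝓗) − c·1` with `𝓗` Hermitian (Nambu data of the free trial Hamiltonian `A`). Then for every real `β`,
with `F = (1 + e^{β𝓗})⁻¹`, the Gibbs state of `A` evaluates `A'` as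
`Re⟨A'⟩_{β,A} = Re(Σ_{ij} 𝓗_{ij}F_{ji} − c) + a·Re Σ_x (F_{x↑,x↑} + 1 − F_{x↓,x↓}) + U·Re Σ_x (F_{x↑,x↑}(1 − F_{x↓,x↓}) + F_{x↓,x↑}F_{x↑,x↓})`
(§3–§4 of files I–II; the equality behind `groundEnergy_le_HFBCS_of_conj`). [cite: BachLiebSolovej1994, §2] [cite: Gaudin1960]
[cite: Lieb1989, proof of Theorem 2] -/
theorem re_gibbsState_eq_HFBCS_of_conj {A A' : Matrix (Finset (Orb Λ)) (Finset (Orb Λ)) ℂ} {a U : ℝ}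
    (hdec : A' = A + (a : ℂ) • totalNumber + (U : ℂ) • ∑ x : Λ, numberOp x 0 * numberOp x 1)
    {𝓗 : Matrix (Orb Λ) (Orb Λ) ℂ} (h𝓗 : 𝓗.IsHermitian) {c : ℂ}
    (hA : partialParticleHole (spinDownOrbitals : Finset (Orb Λ)) * A *
      (partialParticleHole (spinDownOrbitals : Finset (Orb Λ)))ᴴ = dGamma 𝓗 - c • 1) (β : ℝ) :
    (gibbsState β A A').re =
      ((∑ i : Orb Λ, ∑ j : Orb Λ, 𝓗 i j * (1 + NormedSpace.exp ((β : ℂ) • 𝓗))⁻¹ j i) - c).re +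
        a * (∑ x : Λ,
          ((1 + NormedSpace.exp ((β : ℂ) • 𝓗))⁻¹ (orb x 0) (orb x 0) +
            (1 - (1 + NormedSpace.exp ((β : ℂ) • 𝓗))⁻¹ (orb x 1) (orb x 1)))).re +
        U * (∑ x : Λ,
          ((1 + NormedSpace.exp ((β : ℂ) • 𝓗))⁻¹ (orb x 0) (orb x 0) *
              (1 - (1 + NormedSpace.exp ((β : ℂ) • 𝓗))⁻¹ (orb x 1) (orb x 1)) +
            (1 + NormedSpace.exp ((β : ℂ) • 𝓗))⁻¹ (orb x 1) (orb x 0) *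
              (1 + NormedSpace.exp ((β : ℂ) • 𝓗))⁻¹ (orb x 0) (orb x 1))).re := by
  have hexp : gibbsState β A A' = gibbsState β A A + (a : ℂ) * gibbsState β A totalNumber +
      (U : ℂ) * gibbsState β A (∑ x : Λ, numberOp x 0 * numberOp x 1) := by
    rw [hdec, map_add, map_add, LinearMap.map_smul_of_tower, LinearMap.map_smul_of_tower, smul_eq_mul, smul_eq_mul]
  have e3 : gibbsState β A (∑ x : Λ, numberOp x 0 * numberOp x 1) =
      ∑ x : Λ, ((1 + NormedSpace.exp ((β : ℂ) • 𝓗))⁻¹ (orb x 0) (orb x 0) *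
            (1 - (1 + NormedSpace.exp ((β : ℂ) • 𝓗))⁻¹ (orb x 1) (orb x 1)) +
          (1 + NormedSpace.exp ((β : ℂ) • 𝓗))⁻¹ (orb x 1) (orb x 0) *
            (1 + NormedSpace.exp ((β : ℂ) • 𝓗))⁻¹ (orb x 0) (orb x 1)) := by
    rw [map_sum]
    exact Finset.sum_congr rfl fun x _ => gibbsState_docc_of_conj h𝓗 hA β x
  rw [hexp, gibbsState_self_of_conj h𝓗 hA, gibbsState_totalNumber_of_conj h𝓗 hA, e3, Complex.add_re, Complex.add_re,
    Complex.re_ofReal_mul, Complex.re_ofReal_mul]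

end HFBCS

/-! ### §2 The free `d`-wave pinned torus: Nambu and momentum forms of the expectation rows -/

section Torus

variable (L : ℕ) [NeZero L]

/-- **HF–BCS expectation identity for the `d`-wave pinned Hubbard torus (finite torus, exact; library instances)**:
the free pinned Gibbs state `⟨·⟩_{β, A_L(0,μ',h)}` evaluates the interacting pinned Hamiltonian `A_L(U,μ,h)` as the
Nambu-form generalized-Hartree–Fock energy (the equality behind `groundEnergy_dWaveSourceTorus_le_HFBCS`).
[cite: BachLiebSolovej1994, §2] [cite: Lieb1989, proof of Theorem 2] -/
theorem re_gibbsState_dWaveSourceTorus_eq_HFBCS (U μ μ' h β : ℝ) :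
    (gibbsState β (dWaveSourceTorus L 0 μ' h) (dWaveSourceTorus L U μ h)).re =
      ((∑ i : Orb (FermionTorus 2 L), ∑ j : Orb (FermionTorus 2 L),
          (bdgNambuMatrix
              (fun x y => if (fermionTorusGraph 2 L).Adj x y then -(1 : ℂ) else 0)
              (fun u v : FermionTorus 2 L => -(h : ℂ) * ∑ i : Fin 2,
                if v = FermionTorus.ofTorusSite (u.toTorusSite + Pi.single i 1) then
                  ((Real.sqrt 2 * (if i = 0 then 1 else -1) : ℝ) : ℂ) else 0) μ') i j *
            (1 + NormedSpace.exp ((β : ℂ) • bdgNambuMatrix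
              (fun x y => if (fermionTorusGraph 2 L).Adj x y then -(1 : ℂ) else 0)
              (fun u v : FermionTorus 2 L => -(h : ℂ) * ∑ i : Fin 2,
                if v = FermionTorus.ofTorusSite (u.toTorusSite + Pi.single i 1) then
                  ((Real.sqrt 2 * (if i = 0 then 1 else -1) : ℝ) : ℂ) else 0) μ'))⁻¹ j i) -
          (μ' : ℂ) * (L : ℂ) ^ 2).re +
        (μ' - μ) * (∑ x : FermionTorus 2 L,
          ((1 + NormedSpace.exp ((β : ℂ) • bdgNambuMatrix
              (fun x y => if (fermionTorusGraph 2 L).Adj x y then -(1 : ℂ) else 0)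
              (fun u v : FermionTorus 2 L => -(h : ℂ) * ∑ i : Fin 2,
                if v = FermionTorus.ofTorusSite (u.toTorusSite + Pi.single i 1) then
                  ((Real.sqrt 2 * (if i = 0 then 1 else -1) : ℝ) : ℂ) else 0) μ'))⁻¹ (orb x 0) (orb x 0) +
            (1 - (1 + NormedSpace.exp ((β : ℂ) • bdgNambuMatrix
              (fun x y => if (fermionTorusGraph 2 L).Adj x y then -(1 : ℂ) else 0)
              (fun u v : FermionTorus 2 L => -(h : ℂ) * ∑ i : Fin 2,
                if v = FermionTorus.ofTorusSite (u.toTorusSite + Pi.single i 1) then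
                  ((Real.sqrt 2 * (if i = 0 then 1 else -1) : ℝ) : ℂ) else 0) μ'))⁻¹ (orb x 1) (orb x 1)))).re +
        U * (∑ x : FermionTorus 2 L,
          ((1 + NormedSpace.exp ((β : ℂ) • bdgNambuMatrix
              (fun x y => if (fermionTorusGraph 2 L).Adj x y then -(1 : ℂ) else 0)
              (fun u v : FermionTorus 2 L => -(h : ℂ) * ∑ i : Fin 2,
                if v = FermionTorus.ofTorusSite (u.toTorusSite + Pi.single i 1) then
                  ((Real.sqrt 2 * (if i = 0 then 1 else -1) : ℝ) : ℂ) else 0) μ'))⁻¹ (orb x 0) (orb x 0) *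
              (1 - (1 + NormedSpace.exp ((β : ℂ) • bdgNambuMatrix
              (fun x y => if (fermionTorusGraph 2 L).Adj x y then -(1 : ℂ) else 0)
              (fun u v : FermionTorus 2 L => -(h : ℂ) * ∑ i : Fin 2,
                if v = FermionTorus.ofTorusSite (u.toTorusSite + Pi.single i 1) then
                  ((Real.sqrt 2 * (if i = 0 then 1 else -1) : ℝ) : ℂ) else 0) μ'))⁻¹ (orb x 1) (orb x 1)) +
            (1 + NormedSpace.exp ((β : ℂ) • bdgNambuMatrix
              (fun x y => if (fermionTorusGraph 2 L).Adj x y then -(1 : ℂ) else 0)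
              (fun u v : FermionTorus 2 L => -(h : ℂ) * ∑ i : Fin 2,
                if v = FermionTorus.ofTorusSite (u.toTorusSite + Pi.single i 1) then
                  ((Real.sqrt 2 * (if i = 0 then 1 else -1) : ℝ) : ℂ) else 0) μ'))⁻¹ (orb x 1) (orb x 0) *
              (1 + NormedSpace.exp ((β : ℂ) • bdgNambuMatrix
              (fun x y => if (fermionTorusGraph 2 L).Adj x y then -(1 : ℂ) else 0)
              (fun u v : FermionTorus 2 L => -(h : ℂ) * ∑ i : Fin 2,
                if v = FermionTorus.ofTorusSite (u.toTorusSite + Pi.single i 1) then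
                  ((Real.sqrt 2 * (if i = 0 then 1 else -1) : ℝ) : ℂ) else 0) μ'))⁻¹ (orb x 0) (orb x 1))).re := by
  have key := re_gibbsState_eq_HFBCS_of_conj (Λ := FermionTorus 2 L)
    (dWaveSourceTorus_eq_free_add L U μ μ' h) (isHermitian_dWaveNambu L μ' h)
    (c := (μ' : ℂ) * (L : ℂ) ^ 2) (by
      -- the library `DecidableEq` of the concrete torus versus the `LinearOrder`-derived one of the generic lemma
      convert dWaveSource_free_conj_nambu L μ' h using 7) β
  convert key using 40

variable {L}

/-- **The sourced-energy expectation in MOMENTUM SPACE** (`L ≥ 3`; anomalous square kept): with `ξ_k = ε_L(k) − μ'`,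
`g_k = 2√2 h ĝ_d(k)`, `E_k = √(ξ_k² + g_k²)`, `t_k = tanh(βE_k/2)`,
`Re⟨A_L(U,μ,h)⟩_{β,A_L(0,μ',h)} = (−Σ_k E_k t_k − μ'L²) + (μ' − μ)·Σ_k(1 − ξ_k t_k/E_k)
   + U·L²·[(Σ_k(1 − ξ_k t_k/E_k)/(2L²))² + (Σ_k g_k t_k/(2E_k)/L²)²]` (the Bloch–Fourier/BdG evaluation of file III,
as an equality). [cite: BachLiebSolovej1994, §2] [cite: VondelftRalph2001, §4.2] -/
theorem re_gibbsState_dWaveSourceTorus_eq_kSpace (hL : 3 ≤ L) (U μ μ' h β : ℝ) :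
    (gibbsState β (dWaveSourceTorus L 0 μ' h) (dWaveSourceTorus L U μ h)).re =
      (-(∑ k : TorusSite 2 L, Real.sqrt ((torusBand L k - μ') ^ 2 + (2 * Real.sqrt 2 * h * dWaveGap k) ^ 2) * Real.tanh (β * Real.sqrt ((torusBand L k - μ') ^ 2 + (2 * Real.sqrt 2 * h * dWaveGap k) ^ 2) / 2)) - μ' * (L : ℝ) ^ 2) +
        (μ' - μ) * (∑ k : TorusSite 2 L, (1 - (torusBand L k - μ') * Real.tanh (β * Real.sqrt ((torusBand L k - μ') ^ 2 + (2 * Real.sqrt 2 * h * dWaveGap k) ^ 2) / 2) / Real.sqrt ((torusBand L k - μ') ^ 2 + (2 * Real.sqrt 2 * h * dWaveGap k) ^ 2))) +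
        U * ((L : ℝ) ^ 2 *
          (((∑ k : TorusSite 2 L, (1 - (torusBand L k - μ') * Real.tanh (β * Real.sqrt ((torusBand L k - μ') ^ 2 + (2 * Real.sqrt 2 * h * dWaveGap k) ^ 2) / 2) / Real.sqrt ((torusBand L k - μ') ^ 2 + (2 * Real.sqrt 2 * h * dWaveGap k) ^ 2))) / (2 * (L : ℝ) ^ 2)) ^ 2 +
           ((∑ k : TorusSite 2 L, (2 * Real.sqrt 2 * h * dWaveGap k) * Real.tanh (β * Real.sqrt ((torusBand L k - μ') ^ 2 + (2 * Real.sqrt 2 * h * dWaveGap k) ^ 2) / 2) / (2 * Real.sqrt ((torusBand L k - μ') ^ 2 + (2 * Real.sqrt 2 * h * dWaveGap k) ^ 2))) / (L : ℝ) ^ 2) ^ 2)) := by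
  have hL0 : ((L : ℂ) ^ 2) ≠ 0 := by
    have : (L : ℂ) ≠ 0 := by exact_mod_cast NeZero.ne L
    positivity
  have hL0r : ((L : ℝ) ^ 2) ≠ 0 := by
    have : (L : ℝ) ≠ 0 := by exact_mod_cast NeZero.ne L
    positivity
  have hcard : (Fintype.card (FermionTorus 2 L) : ℂ) = (L : ℂ) ^ 2 := by
    simp [FermionTorus, Fintype.card_lex]
  have hcardkR : (Fintype.card (TorusSite 2 L) : ℝ) = (L : ℝ) ^ 2 := by
    rw [Fintype.card_fun, ZMod.card, Fintype.card_fin]; push_cast; ring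
  have key := re_gibbsState_dWaveSourceTorus_eq_HFBCS L U μ μ' h β
  rw [sum_dWaveNambu_mul_fermiMatrix_eq hL μ' h β] at key
  simp only [fermiMatrix_dWaveNambu_diag hL μ' h β, if_true, one_ne_zero, if_false, Finset.sum_const,
    Finset.card_univ, nsmul_eq_mul, hcard] at key
  -- the three complex expressions are casts of real ones
  have hX : (((-∑ k : TorusSite 2 L, Real.sqrt ((torusBand L k - μ') ^ 2 + (2 * Real.sqrt 2 * h * dWaveGap k) ^ 2) * Real.tanh (β * Real.sqrt ((torusBand L k - μ') ^ 2 + (2 * Real.sqrt 2 * h * dWaveGap k) ^ 2) / 2) : ℝ) : ℂ) - (μ' : ℂ) * (L : ℂ) ^ 2) =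
      (((-∑ k : TorusSite 2 L, Real.sqrt ((torusBand L k - μ') ^ 2 + (2 * Real.sqrt 2 * h * dWaveGap k) ^ 2) * Real.tanh (β * Real.sqrt ((torusBand L k - μ') ^ 2 + (2 * Real.sqrt 2 * h * dWaveGap k) ^ 2) / 2)) - μ' * (L : ℝ) ^ 2 : ℝ) : ℂ) := by
    push_cast; ring
  have hY : ((L : ℂ) ^ 2 * (((L : ℂ) ^ 2)⁻¹ * ∑ k : TorusSite 2 L, ((1 / 2 - Real.tanh (β * Real.sqrt ((torusBand L k - μ') ^ 2 + (2 * Real.sqrt 2 * h * dWaveGap k) ^ 2) / 2) / (2 * Real.sqrt ((torusBand L k - μ') ^ 2 + (2 * Real.sqrt 2 * h * dWaveGap k) ^ 2)) * (torusBand L k - μ') : ℝ) : ℂ) +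
        (1 - ((L : ℂ) ^ 2)⁻¹ * ∑ k : TorusSite 2 L, ((1 / 2 + Real.tanh (β * Real.sqrt ((torusBand L k - μ') ^ 2 + (2 * Real.sqrt 2 * h * dWaveGap k) ^ 2) / 2) / (2 * Real.sqrt ((torusBand L k - μ') ^ 2 + (2 * Real.sqrt 2 * h * dWaveGap k) ^ 2)) * (torusBand L k - μ') : ℝ) : ℂ)))) =
      (((L : ℝ) ^ 2 * (((L : ℝ) ^ 2)⁻¹ * ∑ k : TorusSite 2 L, (1 / 2 - Real.tanh (β * Real.sqrt ((torusBand L k - μ') ^ 2 + (2 * Real.sqrt 2 * h * dWaveGap k) ^ 2) / 2) / (2 * Real.sqrt ((torusBand L k - μ') ^ 2 + (2 * Real.sqrt 2 * h * dWaveGap k) ^ 2)) * (torusBand L k - μ')) +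
        (1 - ((L : ℝ) ^ 2)⁻¹ * ∑ k : TorusSite 2 L, (1 / 2 + Real.tanh (β * Real.sqrt ((torusBand L k - μ') ^ 2 + (2 * Real.sqrt 2 * h * dWaveGap k) ^ 2) / 2) / (2 * Real.sqrt ((torusBand L k - μ') ^ 2 + (2 * Real.sqrt 2 * h * dWaveGap k) ^ 2)) * (torusBand L k - μ')))) : ℝ) : ℂ) := by
    push_cast; ring
  have hZ : ((L : ℂ) ^ 2 * ((((L : ℂ) ^ 2)⁻¹ * ∑ k : TorusSite 2 L, ((1 / 2 - Real.tanh (β * Real.sqrt ((torusBand L k - μ') ^ 2 + (2 * Real.sqrt 2 * h * dWaveGap k) ^ 2) / 2) / (2 * Real.sqrt ((torusBand L k - μ') ^ 2 + (2 * Real.sqrt 2 * h * dWaveGap k) ^ 2)) * (torusBand L k - μ') : ℝ) : ℂ)) *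
        (1 - ((L : ℂ) ^ 2)⁻¹ * ∑ k : TorusSite 2 L, ((1 / 2 + Real.tanh (β * Real.sqrt ((torusBand L k - μ') ^ 2 + (2 * Real.sqrt 2 * h * dWaveGap k) ^ 2) / 2) / (2 * Real.sqrt ((torusBand L k - μ') ^ 2 + (2 * Real.sqrt 2 * h * dWaveGap k) ^ 2)) * (torusBand L k - μ') : ℝ) : ℂ)) +
        (((L : ℂ) ^ 2)⁻¹ * ∑ k : TorusSite 2 L, ((-(Real.tanh (β * Real.sqrt ((torusBand L k - μ') ^ 2 + (2 * Real.sqrt 2 * h * dWaveGap k) ^ 2) / 2) / (2 * Real.sqrt ((torusBand L k - μ') ^ 2 + (2 * Real.sqrt 2 * h * dWaveGap k) ^ 2)) * (2 * Real.sqrt 2 * h * dWaveGap k)) : ℝ) : ℂ)) *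
        (((L : ℂ) ^ 2)⁻¹ * ∑ k : TorusSite 2 L, ((-(Real.tanh (β * Real.sqrt ((torusBand L k - μ') ^ 2 + (2 * Real.sqrt 2 * h * dWaveGap k) ^ 2) / 2) / (2 * Real.sqrt ((torusBand L k - μ') ^ 2 + (2 * Real.sqrt 2 * h * dWaveGap k) ^ 2)) * (2 * Real.sqrt 2 * h * dWaveGap k)) : ℝ) : ℂ)))) =
      (((L : ℝ) ^ 2 * ((((L : ℝ) ^ 2)⁻¹ * ∑ k : TorusSite 2 L, (1 / 2 - Real.tanh (β * Real.sqrt ((torusBand L k - μ') ^ 2 + (2 * Real.sqrt 2 * h * dWaveGap k) ^ 2) / 2) / (2 * Real.sqrt ((torusBand L k - μ') ^ 2 + (2 * Real.sqrt 2 * h * dWaveGap k) ^ 2)) * (torusBand L k - μ'))) *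
        (1 - ((L : ℝ) ^ 2)⁻¹ * ∑ k : TorusSite 2 L, (1 / 2 + Real.tanh (β * Real.sqrt ((torusBand L k - μ') ^ 2 + (2 * Real.sqrt 2 * h * dWaveGap k) ^ 2) / 2) / (2 * Real.sqrt ((torusBand L k - μ') ^ 2 + (2 * Real.sqrt 2 * h * dWaveGap k) ^ 2)) * (torusBand L k - μ'))) +
        (((L : ℝ) ^ 2)⁻¹ * ∑ k : TorusSite 2 L, (-(Real.tanh (β * Real.sqrt ((torusBand L k - μ') ^ 2 + (2 * Real.sqrt 2 * h * dWaveGap k) ^ 2) / 2) / (2 * Real.sqrt ((torusBand L k - μ') ^ 2 + (2 * Real.sqrt 2 * h * dWaveGap k) ^ 2)) * (2 * Real.sqrt 2 * h * dWaveGap k)))) *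
        (((L : ℝ) ^ 2)⁻¹ * ∑ k : TorusSite 2 L, (-(Real.tanh (β * Real.sqrt ((torusBand L k - μ') ^ 2 + (2 * Real.sqrt 2 * h * dWaveGap k) ^ 2) / 2) / (2 * Real.sqrt ((torusBand L k - μ') ^ 2 + (2 * Real.sqrt 2 * h * dWaveGap k) ^ 2)) * (2 * Real.sqrt 2 * h * dWaveGap k))))) : ℝ) : ℂ) := by
    push_cast; ring
  rw [hX, hY, hZ, Complex.ofReal_re, Complex.ofReal_re, Complex.ofReal_re] at key
  refine key.trans ?_
  -- real bookkeeping of the momentum sums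
  have hA : ∑ k : TorusSite 2 L, (1 / 2 - Real.tanh (β * Real.sqrt ((torusBand L k - μ') ^ 2 + (2 * Real.sqrt 2 * h * dWaveGap k) ^ 2) / 2) / (2 * Real.sqrt ((torusBand L k - μ') ^ 2 + (2 * Real.sqrt 2 * h * dWaveGap k) ^ 2)) * (torusBand L k - μ')) =
      (L : ℝ) ^ 2 / 2 - ∑ k : TorusSite 2 L, Real.tanh (β * Real.sqrt ((torusBand L k - μ') ^ 2 + (2 * Real.sqrt 2 * h * dWaveGap k) ^ 2) / 2) / (2 * Real.sqrt ((torusBand L k - μ') ^ 2 + (2 * Real.sqrt 2 * h * dWaveGap k) ^ 2)) * (torusBand L k - μ') := by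
    rw [Finset.sum_sub_distrib, Finset.sum_const, Finset.card_univ, nsmul_eq_mul, hcardkR]; ring
  have hB : ∑ k : TorusSite 2 L, (1 / 2 + Real.tanh (β * Real.sqrt ((torusBand L k - μ') ^ 2 + (2 * Real.sqrt 2 * h * dWaveGap k) ^ 2) / 2) / (2 * Real.sqrt ((torusBand L k - μ') ^ 2 + (2 * Real.sqrt 2 * h * dWaveGap k) ^ 2)) * (torusBand L k - μ')) =
      (L : ℝ) ^ 2 / 2 + ∑ k : TorusSite 2 L, Real.tanh (β * Real.sqrt ((torusBand L k - μ') ^ 2 + (2 * Real.sqrt 2 * h * dWaveGap k) ^ 2) / 2) / (2 * Real.sqrt ((torusBand L k - μ') ^ 2 + (2 * Real.sqrt 2 * h * dWaveGap k) ^ 2)) * (torusBand L k - μ') := by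
    rw [Finset.sum_add_distrib, Finset.sum_const, Finset.card_univ, nsmul_eq_mul, hcardkR]; ring
  have hC : ∑ k : TorusSite 2 L, (-(Real.tanh (β * Real.sqrt ((torusBand L k - μ') ^ 2 + (2 * Real.sqrt 2 * h * dWaveGap k) ^ 2) / 2) / (2 * Real.sqrt ((torusBand L k - μ') ^ 2 + (2 * Real.sqrt 2 * h * dWaveGap k) ^ 2)) * (2 * Real.sqrt 2 * h * dWaveGap k))) = -∑ k : TorusSite 2 L, Real.tanh (β * Real.sqrt ((torusBand L k - μ') ^ 2 + (2 * Real.sqrt 2 * h * dWaveGap k) ^ 2) / 2) / (2 * Real.sqrt ((torusBand L k - μ') ^ 2 + (2 * Real.sqrt 2 * h * dWaveGap k) ^ 2)) * (2 * Real.sqrt 2 * h * dWaveGap k) := by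
    rw [← Finset.sum_neg_distrib]
  have hN : ∑ k : TorusSite 2 L, (1 - (torusBand L k - μ') * Real.tanh (β * Real.sqrt ((torusBand L k - μ') ^ 2 + (2 * Real.sqrt 2 * h * dWaveGap k) ^ 2) / 2) / Real.sqrt ((torusBand L k - μ') ^ 2 + (2 * Real.sqrt 2 * h * dWaveGap k) ^ 2)) =
      (L : ℝ) ^ 2 - 2 * ∑ k : TorusSite 2 L, Real.tanh (β * Real.sqrt ((torusBand L k - μ') ^ 2 + (2 * Real.sqrt 2 * h * dWaveGap k) ^ 2) / 2) / (2 * Real.sqrt ((torusBand L k - μ') ^ 2 + (2 * Real.sqrt 2 * h * dWaveGap k) ^ 2)) * (torusBand L k - μ') := by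
    rw [Finset.sum_sub_distrib, Finset.sum_const, Finset.card_univ, nsmul_eq_mul, hcardkR, Finset.mul_sum, mul_one]
    congr 1
    exact Finset.sum_congr rfl fun k _ => by ring
  have hC' : ∑ k : TorusSite 2 L, (2 * Real.sqrt 2 * h * dWaveGap k) * Real.tanh (β * Real.sqrt ((torusBand L k - μ') ^ 2 + (2 * Real.sqrt 2 * h * dWaveGap k) ^ 2) / 2) / (2 * Real.sqrt ((torusBand L k - μ') ^ 2 + (2 * Real.sqrt 2 * h * dWaveGap k) ^ 2)) =
      ∑ k : TorusSite 2 L, Real.tanh (β * Real.sqrt ((torusBand L k - μ') ^ 2 + (2 * Real.sqrt 2 * h * dWaveGap k) ^ 2) / 2) / (2 * Real.sqrt ((torusBand L k - μ') ^ 2 + (2 * Real.sqrt 2 * h * dWaveGap k) ^ 2)) * (2 * Real.sqrt 2 * h * dWaveGap k) :=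
    Finset.sum_congr rfl fun k _ => by ring
  rw [hA, hB, hC, hN, hC']
  generalize (∑ k : TorusSite 2 L, Real.tanh (β * Real.sqrt ((torusBand L k - μ') ^ 2 + (2 * Real.sqrt 2 * h * dWaveGap k) ^ 2) / 2) / (2 * Real.sqrt ((torusBand L k - μ') ^ 2 + (2 * Real.sqrt 2 * h * dWaveGap k) ^ 2)) * (torusBand L k - μ')) = D
  generalize (∑ k : TorusSite 2 L, Real.tanh (β * Real.sqrt ((torusBand L k - μ') ^ 2 + (2 * Real.sqrt 2 * h * dWaveGap k) ^ 2) / 2) / (2 * Real.sqrt ((torusBand L k - μ') ^ 2 + (2 * Real.sqrt 2 * h * dWaveGap k) ^ 2)) * (2 * Real.sqrt 2 * h * dWaveGap k)) = Cg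
  generalize (∑ k : TorusSite 2 L, Real.sqrt ((torusBand L k - μ') ^ 2 + (2 * Real.sqrt 2 * h * dWaveGap k) ^ 2) * Real.tanh (β * Real.sqrt ((torusBand L k - μ') ^ 2 + (2 * Real.sqrt 2 * h * dWaveGap k) ^ 2) / 2)) = Et
  field_simp
  ring

/-- **The sourced-energy expectation in momentum space, anomalous term removed** (`L ≥ 3`):
`Re⟨A_L(U,μ,h)⟩_{β,A_L(0,μ',h)} = (−Σ_k E_k t_k − μ'L²) + (μ' − μ)·Σ_k(1 − ξ_k t_k/E_k) + U·L²·(Σ_k(1 − ξ_k t_k/E_k)/(2L²))²`.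
[cite: BachLiebSolovej1994, §2] [cite: VondelftRalph2001, §4.2] -/
theorem re_gibbsState_dWaveSourceTorus_eq_kSpace' (hL : 3 ≤ L) (U μ μ' h β : ℝ) :
    (gibbsState β (dWaveSourceTorus L 0 μ' h) (dWaveSourceTorus L U μ h)).re =
      (-(∑ k : TorusSite 2 L, Real.sqrt ((torusBand L k - μ') ^ 2 + (2 * Real.sqrt 2 * h * dWaveGap k) ^ 2) * Real.tanh (β * Real.sqrt ((torusBand L k - μ') ^ 2 + (2 * Real.sqrt 2 * h * dWaveGap k) ^ 2) / 2)) - μ' * (L : ℝ) ^ 2) +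
        (μ' - μ) * (∑ k : TorusSite 2 L, (1 - (torusBand L k - μ') * Real.tanh (β * Real.sqrt ((torusBand L k - μ') ^ 2 + (2 * Real.sqrt 2 * h * dWaveGap k) ^ 2) / 2) / Real.sqrt ((torusBand L k - μ') ^ 2 + (2 * Real.sqrt 2 * h * dWaveGap k) ^ 2))) +
        U * ((L : ℝ) ^ 2 *
          ((∑ k : TorusSite 2 L, (1 - (torusBand L k - μ') * Real.tanh (β * Real.sqrt ((torusBand L k - μ') ^ 2 + (2 * Real.sqrt 2 * h * dWaveGap k) ^ 2) / 2) / Real.sqrt ((torusBand L k - μ') ^ 2 + (2 * Real.sqrt 2 * h * dWaveGap k) ^ 2))) / (2 * (L : ℝ) ^ 2)) ^ 2) := by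
  have key := re_gibbsState_dWaveSourceTorus_eq_kSpace hL U μ μ' h β
  rw [sum_dWave_anomalous_eq_zero μ' h β, zero_div, sq (0 : ℝ), mul_zero, add_zero] at key
  exact key

/-- **The number expectation in momentum space** (`L ≥ 3`): the trial density per site of the free `d`-wave pinned
Gibbs state is `n_L = L⁻²·Σ_k(1 − ξ_k t_k/E_k)`, i.e. `Re⟨N⟩_{β,A_L(0,μ',h)} = Σ_k (1 − ξ_k t_k/E_k)`
(`gibbsState_totalNumber_of_conj` + `fermiMatrix_dWaveNambu_diag`). [cite: BratteliRobinsonII1997, §5.2.4]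
[cite: VondelftRalph2001, §4.2] -/
theorem re_gibbsState_dWaveSourceTorus_totalNumber_eq_kSpace (hL : 3 ≤ L) (μ' h β : ℝ) :
    (gibbsState β (dWaveSourceTorus L 0 μ' h) totalNumber).re = (∑ k : TorusSite 2 L, (1 - (torusBand L k - μ') * Real.tanh (β * Real.sqrt ((torusBand L k - μ') ^ 2 + (2 * Real.sqrt 2 * h * dWaveGap k) ^ 2) / 2) / Real.sqrt ((torusBand L k - μ') ^ 2 + (2 * Real.sqrt 2 * h * dWaveGap k) ^ 2))) := by
  have hL0 : ((L : ℂ) ^ 2) ≠ 0 := by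
    have : (L : ℂ) ≠ 0 := by exact_mod_cast NeZero.ne L
    positivity
  have hcard : (Fintype.card (FermionTorus 2 L) : ℂ) = (L : ℂ) ^ 2 := by
    simp [FermionTorus, Fintype.card_lex]
  have hcardkR : (Fintype.card (TorusSite 2 L) : ℝ) = (L : ℝ) ^ 2 := by
    rw [Fintype.card_fun, ZMod.card, Fintype.card_fin]; push_cast; ring
  have key : gibbsState β (dWaveSourceTorus L 0 μ' h) totalNumber = (∑ x : FermionTorus 2 L,
          ((1 + NormedSpace.exp ((β : ℂ) • bdgNambuMatrix
              (fun x y => if (fermionTorusGraph 2 L).Adj x y then -(1 : ℂ) else 0)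
              (fun u v : FermionTorus 2 L => -(h : ℂ) * ∑ i : Fin 2,
                if v = FermionTorus.ofTorusSite (u.toTorusSite + Pi.single i 1) then
                  ((Real.sqrt 2 * (if i = 0 then 1 else -1) : ℝ) : ℂ) else 0) μ'))⁻¹ (orb x 0) (orb x 0) +
            (1 - (1 + NormedSpace.exp ((β : ℂ) • bdgNambuMatrix
              (fun x y => if (fermionTorusGraph 2 L).Adj x y then -(1 : ℂ) else 0)
              (fun u v : FermionTorus 2 L => -(h : ℂ) * ∑ i : Fin 2,
                if v = FermionTorus.ofTorusSite (u.toTorusSite + Pi.single i 1) then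
                  ((Real.sqrt 2 * (if i = 0 then 1 else -1) : ℝ) : ℂ) else 0) μ'))⁻¹ (orb x 1) (orb x 1)))) := by
    have key0 := gibbsState_totalNumber_of_conj (Λ := FermionTorus 2 L) (isHermitian_dWaveNambu L μ' h)
      (c := (μ' : ℂ) * (L : ℂ) ^ 2) (by convert dWaveSource_free_conj_nambu L μ' h using 7) β
    convert key0 using 40
  rw [key]
  simp only [fermiMatrix_dWaveNambu_diag hL μ' h β, if_true, one_ne_zero, if_false, Finset.sum_const,
    Finset.card_univ, nsmul_eq_mul, hcard]
  have hY : ((L : ℂ) ^ 2 * (((L : ℂ) ^ 2)⁻¹ * ∑ k : TorusSite 2 L, ((1 / 2 - Real.tanh (β * Real.sqrt ((torusBand L k - μ') ^ 2 + (2 * Real.sqrt 2 * h * dWaveGap k) ^ 2) / 2) / (2 * Real.sqrt ((torusBand L k - μ') ^ 2 + (2 * Real.sqrt 2 * h * dWaveGap k) ^ 2)) * (torusBand L k - μ') : ℝ) : ℂ) +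
        (1 - ((L : ℂ) ^ 2)⁻¹ * ∑ k : TorusSite 2 L, ((1 / 2 + Real.tanh (β * Real.sqrt ((torusBand L k - μ') ^ 2 + (2 * Real.sqrt 2 * h * dWaveGap k) ^ 2) / 2) / (2 * Real.sqrt ((torusBand L k - μ') ^ 2 + (2 * Real.sqrt 2 * h * dWaveGap k) ^ 2)) * (torusBand L k - μ') : ℝ) : ℂ)))) =
      (((L : ℝ) ^ 2 * (((L : ℝ) ^ 2)⁻¹ * ∑ k : TorusSite 2 L, (1 / 2 - Real.tanh (β * Real.sqrt ((torusBand L k - μ') ^ 2 + (2 * Real.sqrt 2 * h * dWaveGap k) ^ 2) / 2) / (2 * Real.sqrt ((torusBand L k - μ') ^ 2 + (2 * Real.sqrt 2 * h * dWaveGap k) ^ 2)) * (torusBand L k - μ')) +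
        (1 - ((L : ℝ) ^ 2)⁻¹ * ∑ k : TorusSite 2 L, (1 / 2 + Real.tanh (β * Real.sqrt ((torusBand L k - μ') ^ 2 + (2 * Real.sqrt 2 * h * dWaveGap k) ^ 2) / 2) / (2 * Real.sqrt ((torusBand L k - μ') ^ 2 + (2 * Real.sqrt 2 * h * dWaveGap k) ^ 2)) * (torusBand L k - μ')))) : ℝ) : ℂ) := by
    push_cast; ring
  rw [hY, Complex.ofReal_re]
  have hA : ∑ k : TorusSite 2 L, (1 / 2 - Real.tanh (β * Real.sqrt ((torusBand L k - μ') ^ 2 + (2 * Real.sqrt 2 * h * dWaveGap k) ^ 2) / 2) / (2 * Real.sqrt ((torusBand L k - μ') ^ 2 + (2 * Real.sqrt 2 * h * dWaveGap k) ^ 2)) * (torusBand L k - μ')) =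
      (L : ℝ) ^ 2 / 2 - ∑ k : TorusSite 2 L, Real.tanh (β * Real.sqrt ((torusBand L k - μ') ^ 2 + (2 * Real.sqrt 2 * h * dWaveGap k) ^ 2) / 2) / (2 * Real.sqrt ((torusBand L k - μ') ^ 2 + (2 * Real.sqrt 2 * h * dWaveGap k) ^ 2)) * (torusBand L k - μ') := by
    rw [Finset.sum_sub_distrib, Finset.sum_const, Finset.card_univ, nsmul_eq_mul, hcardkR]; ring
  have hB : ∑ k : TorusSite 2 L, (1 / 2 + Real.tanh (β * Real.sqrt ((torusBand L k - μ') ^ 2 + (2 * Real.sqrt 2 * h * dWaveGap k) ^ 2) / 2) / (2 * Real.sqrt ((torusBand L k - μ') ^ 2 + (2 * Real.sqrt 2 * h * dWaveGap k) ^ 2)) * (torusBand L k - μ')) =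
      (L : ℝ) ^ 2 / 2 + ∑ k : TorusSite 2 L, Real.tanh (β * Real.sqrt ((torusBand L k - μ') ^ 2 + (2 * Real.sqrt 2 * h * dWaveGap k) ^ 2) / 2) / (2 * Real.sqrt ((torusBand L k - μ') ^ 2 + (2 * Real.sqrt 2 * h * dWaveGap k) ^ 2)) * (torusBand L k - μ') := by
    rw [Finset.sum_add_distrib, Finset.sum_const, Finset.card_univ, nsmul_eq_mul, hcardkR]; ring
  have hN : (∑ k : TorusSite 2 L, (1 - (torusBand L k - μ') * Real.tanh (β * Real.sqrt ((torusBand L k - μ') ^ 2 + (2 * Real.sqrt 2 * h * dWaveGap k) ^ 2) / 2) / Real.sqrt ((torusBand L k - μ') ^ 2 + (2 * Real.sqrt 2 * h * dWaveGap k) ^ 2))) =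
      (L : ℝ) ^ 2 - 2 * ∑ k : TorusSite 2 L, Real.tanh (β * Real.sqrt ((torusBand L k - μ') ^ 2 + (2 * Real.sqrt 2 * h * dWaveGap k) ^ 2) / 2) / (2 * Real.sqrt ((torusBand L k - μ') ^ 2 + (2 * Real.sqrt 2 * h * dWaveGap k) ^ 2)) * (torusBand L k - μ') := by
    rw [Finset.sum_sub_distrib, Finset.sum_const, Finset.card_univ, nsmul_eq_mul, hcardkR, Finset.mul_sum, mul_one]
    congr 1
    exact Finset.sum_congr rfl fun k _ => by ring
  rw [hA, hB, hN]
  have hL0r : ((L : ℝ) ^ 2) ≠ 0 := by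
    have : (L : ℝ) ≠ 0 := by exact_mod_cast NeZero.ne L
    positivity
  field_simp
  ring

end Torus

end Summit.Ventures.CertifiedManyBodySolver.Observables

end
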